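import Summits.AnomalousDissipation.AnomalousDissipation.Theorems.GalerkinSteadyZerothLaw.Negative.StokesStates
import Literature.Analysis.FluidPDE.NSGalerkinStationary
import Literature.Analysis.Calculus.NewtonKantorovichInfSup
import Literature.Analysis.Calculus.SimplifiedNewton

/-!
# STUB-PLAN `stub_loudCoatDecades` — merged helper-lemma signatures (stub-critic, elaboration sanity)

Crux stmt-AnomalousDissipation-2986 `MirrorVariety.GalerkinSteadyZerothLaw`, line `idea-sketch-ideator2`
(skeleton `Cruxes/GalerkinSteadyZerothLaw/Lines/idea_sketch_ideator2.lean`, sha 39d412c4…; heart `stub_loudCoatDecades`).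
This file types, in ONE namespace and over LANDED vocabulary only, the helper lemmas of
`STUB-PLAN-stub_loudCoatDecades.md` (merged from STUB-IDEAS k1/k2/k3).  Bodies are `sorry`; the plan marks
which conjunctions to register as stubs (`ledger workitem stub-add`).  Tiers:

* §A  tube / path topology + the uniqueness half of Newton–Kantorovich   → `stub_loudCoatTubeTools`
* §B  core restriction + coat window (general core) + single-shell identities → `stub_loudCoatCoreTools`
* §C  coat-chart transport of a force-coordinate family + bookkeeping to the registered signature
       (`SteadyTubeLadder → stub`, conclusion VERBATIM)                  → `stub_loudCoatOfLadder`
* §C' the re-registered heart in force coordinates                        → `stub_steadyTubeLadder`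
* §D  clamp-coordinate packaging of the coat clause (fallback A only).

Landed inputs used by the proofs (by name, not imported here): `Theorems.GalerkinSteadyZerothLaw.coat_chart_onto`
(p90004), `…readout_eq`, `…continuous_dissipation_coat`, `…energy_restrict_eq`, `…coeffExt_restrict_eq` (p88897),
`Literature.Analysis.Calculus.existsUnique_zero_of_simplifiedNewton`, `…exists_zero_of_infSup_newton`,
`Literature.Analysis.FluidPDE.Torus.sum_re_inner_galerkinField_test`, `…galerkinRHS_mem`,
`LaminarNeverLoud.Negative.dissipation_eq_power`, Mathlib `Continuous.homeoOfEquivCompactToT2`,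
`isConnected_Icc`, `intermediate_value_Icc`, `IsPreconnected.Icc_subset`, `isClosedMap_snd_of_compactSpace`.
-/

noncomputable section

set_option linter.dupNamespace false

open scoped InnerProductSpace Topology
open MeasureTheory Filter Set Metric
open Literature.Analysis.FunctionSpaces Literature.Analysis.FunctionSpaces.Torus
open Literature.Analysis.FluidPDE Literature.Analysis.FluidPDE.Torus

namespace Summit.AnomalousDissipation.AnomalousDissipation.Cruxes.GalerkinSteadyZerothLaw.StubPlanLoudCoatDecades

open Summit.AnomalousDissipation.AnomalousDissipation.Theorems.GalerkinSteadyZerothLaw.Negative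
  (SteadyState fieldOf steadyState_fieldOf integral_norm_sq_fieldOf loudness_fieldOf)
open Summit.AnomalousDissipation.AnomalousDissipation.Theorems.LaminarNeverLoud.Negative
  (modes forceCoeff energy dissipation modes_symm zero_not_mem_modes energy_nonneg dissipation_nonpos_of_nonpos)

/-- Coefficient vectors at level `N` (as in the skeleton). -/
abbrev Coeff (N : ℕ) : Type := ↥(modes (Fin 3) N) → EuclideanSpace ℂ (Fin 3)

/-! ## §A  Tube / path topology and N–K uniqueness (register the conjunction as `stub_loudCoatTubeTools`) -/

/-- **A1 `isConnected_of_isCompact_injOn_fst`** (S–M, pure topology; k3-H1).  A compact set over an interval with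
single-valued fibres is connected: `fst|_Z : Z → Icc a b` is a continuous bijection from a compact space to a T₂ space,
hence a homeomorphism (`Continuous.homeoOfEquivCompactToT2`), and `Icc a b` is connected. [folklore] -/
theorem isConnected_of_isCompact_injOn_fst {X : Type*} [TopologicalSpace X] [T2Space X]
    {Z : Set (ℝ × X)} {a b : ℝ} (hab : a ≤ b) (hZ : IsCompact Z)
    (himg : Prod.fst '' Z = Icc a b) (hinj : InjOn Prod.fst Z) : IsConnected Z := by
  sorry

/-- **A2 `coatSet_of_path`** (S, pure topology; k2-H1 — the FOLD-TOLERANT packaging).  The image of a continuous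
path is connected and its first coordinates cover every interval between the endpoints' first coordinates
(`isConnected_Icc.image`, `intermediate_value_Icc` on `Prod.fst ∘ γ`). [folklore] -/
theorem coatSet_of_path {X : Type*} [TopologicalSpace X] (γ : ℝ → ℝ × X)
    (hγ : ContinuousOn γ (Icc (0 : ℝ) 1)) {a b : ℝ} (ha : (γ 0).1 ≤ a) (hb : b ≤ (γ 1).1) :
    IsConnected (γ '' Icc (0 : ℝ) 1) ∧ Icc a b ⊆ Prod.fst '' (γ '' Icc (0 : ℝ) 1) := by
  sorry

/-- **A3 `steadyTube_connected`** (M; k3-H3, absorbing k1-H1/H2).  Existence within `R` of a continuous centre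
curve `v` on `[a, b]` plus uniqueness within `R` ⇒ the tube of zeros is connected and `fst`-projects ONTO `[a, b]`
(closed + bounded in finite dimension ⇒ compact; `fst`-injective by uniqueness; A1).  Degree-free continuation:
no continuity of the selected branch is needed as an input. [folklore] -/
theorem steadyTube_connected {X : Type*} [NormedAddCommGroup X] [NormedSpace ℝ X] [FiniteDimensional ℝ X]
    {Y : Type*} [NormedAddCommGroup Y] (G : ℝ × X → Y) (hG : Continuous G) (v : ℝ → X) {a b R : ℝ}
    (hab : a ≤ b) (hv : ContinuousOn v (Icc a b))
    (hex : ∀ t ∈ Icc a b, ∃ c, G (t, c) = 0 ∧ ‖c - v t‖ ≤ R)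
    (huniq : ∀ t ∈ Icc a b, ∀ c c', G (t, c) = 0 → G (t, c') = 0 → ‖c - v t‖ ≤ R → ‖c' - v t‖ ≤ R → c = c') :
    IsConnected {p : ℝ × X | p.1 ∈ Icc a b ∧ G p = 0 ∧ ‖p.2 - v p.1‖ ≤ R} ∧
      Prod.fst '' {p : ℝ × X | p.1 ∈ Icc a b ∧ G p = 0 ∧ ‖p.2 - v p.1‖ ≤ R} = Icc a b := by
  sorry

/-- **A4 `zero_unique_of_infSup_lipschitz`** (S; k3-H2 — the uniqueness half missing from
`Literature.Analysis.Calculus.exists_zero_of_infSup_newton`, SAME data, no residual needed).  Two zeros within `r`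
of `v` coincide once `2β|M|r < 1`: inf-sup on `x - y` against the centred Lipschitz bound. [folklore] -/
theorem zero_unique_of_infSup_lipschitz {T : Type*} [NormedAddCommGroup T] [NormedSpace ℝ T]
    [FiniteDimensional ℝ T] {Φ : T → T → ℝ} {Λ : T → T → ℝ} {v : T} {β M r : ℝ}
    (hβ : 0 ≤ β) (hΛw : ∀ a, IsLinearMap ℝ fun w => Λ w a)
    (hlip : ∀ x y a, |Φ x a - Φ y a - Λ (x - y) a| ≤ β * (‖x - v‖ + ‖y - v‖) * ‖x - y‖ * ‖a‖)
    (hinf : ∀ w, ∃ a, ‖w‖ * ‖a‖ ≤ M * Λ w a ∧ (0 < ‖w‖ → 0 < ‖a‖))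
    {x y : T} (hx : ∀ a, Φ x a = 0) (hy : ∀ a, Φ y a = 0)
    (hxr : ‖x - v‖ ≤ r) (hyr : ‖y - v‖ ≤ r) (hsmall : 2 * β * |M| * r < 1) : x = y := by
  sorry

/-! ## §B  Core restriction, coat window, single-shell identities (register as `stub_loudCoatCoreTools`) -/

/-- **B1 `eulerCore_restrict`** (S–M; k1-H0 = k2-H2).  If `Cfun` is supported in `modes K₀` and its restriction to
level `2K₀` is a real solenoidal nonzero zero of the unforced inviscid Galerkin field, then so is its restriction to
every level `N ≥ K₀`: reality/transversality are pointwise in `k`; `convectionCoeff (modes N) Ĉ Ĉ k` only sees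
`l, m ∈ supp Cfun ⊆ modes K₀`, so it is level-independent, vanishes for `|k| > 2K₀`, and is killed by `leraySym k`
for `0 < |k| ≤ 2K₀` by the level-`2K₀` identity (`Finset.sum_subset` bookkeeping as in `energy_restrict_eq`).
ONE finite identity (cell core `K₀ = 2`, ABC `K₀ = 1`) then discharges the stub's core clause at every `N`. [folklore] -/
theorem eulerCore_restrict {K₀ : ℕ} {Cfun : (Fin 3 → ℤ) → EuclideanSpace ℂ (Fin 3)}
    (hsupp : ∀ k ∉ modes (Fin 3) K₀, Cfun k = 0)
    (hcore : (fun k : ↥(modes (Fin 3) (2 * K₀)) => Cfun k) ∈ galerkinSubspace (modes (Fin 3) (2 * K₀)) ∧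
      (fun k : ↥(modes (Fin 3) (2 * K₀)) => Cfun k) ≠ 0 ∧
      galerkinRHS (modes (Fin 3) (2 * K₀)) 0 0 (fun k : ↥(modes (Fin 3) (2 * K₀)) => Cfun k) = 0)
    {N : ℕ} (hN : K₀ ≤ N) :
    (fun k : ↥(modes (Fin 3) N) => Cfun k) ∈ galerkinSubspace (modes (Fin 3) N) ∧
      (fun k : ↥(modes (Fin 3) N) => Cfun k) ≠ 0 ∧
      galerkinRHS (modes (Fin 3) N) 0 0 (fun k : ↥(modes (Fin 3) N) => Cfun k) = 0 := by
  sorry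

/-- `ℓ¹` bound for `‖∇C̃‖_∞` of a core shape: `2π ∑_k |k| ‖Cfun k‖`. -/
def strainBound (K₀ : ℕ) (Cfun : (Fin 3 → ℤ) → EuclideanSpace ℂ (Fin 3)) : ℝ :=
  2 * Real.pi * ∑ k ∈ modes (Fin 3) K₀, Real.sqrt (freqNormSq k) * ‖Cfun k‖

/-- **B2 `coat_window`** (S–M, tightness, GENERAL core; k3-H6).  Pair the coat equation with `h`:
`ν‖∇h‖² = −∫⟪h̃,(h̃·∇)C̃⟫ − ν Re⟨AC, h⟩` (`⟨B(C,h),h⟩ = ⟨B(h,h),h⟩ = 0`, `B_N(C,C) = 0`), so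
`energy (C+h) = energy C + energy h` and the TOTAL dissipation is at most the production ceiling
`strainBound·energy h` plus `O(ν)`.  Consequences used by the plan: (i) the instant budget check
`ε₁ ≤ strainBound·(E₁ − E_C) + 16π²K₀²·ρνlo_j·E₁`; (ii) loud coats deep in the ladder have `energy h ≥ (ε₁ − O(ν))/strainBound`
— they are never local-bifurcation objects. [folklore] -/
theorem coat_window (K₀ N : ℕ) (hKN : K₀ ≤ N) (Cfun : (Fin 3 → ℤ) → EuclideanSpace ℂ (Fin 3))
    (hsupp : ∀ k ∉ modes (Fin 3) K₀, Cfun k = 0) (C h : Coeff N) (hCdef : C = fun k : ↥(modes (Fin 3) N) => Cfun k)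
    (hC : C ∈ galerkinSubspace (modes (Fin 3) N)) (hcore : galerkinRHS (modes (Fin 3) N) 0 0 C = 0)
    (ν s : ℝ) (hν : 0 ≤ ν) (hh : h ∈ galerkinSubspace (modes (Fin 3) N))
    (horth : (∑ k, (inner ℂ (C k) (h k)).re) = 0)
    (hs : galerkinRHS (modes (Fin 3) N) ν 0 (C + h) = (-s) • C) :
    energy (C + h) = energy C + energy h ∧
      dissipation ν (C + h) ≤ strainBound K₀ Cfun * energy h +
        2 * ν * (4 * Real.pi ^ 2 * (K₀ : ℝ) ^ 2) * (Real.sqrt (energy C) + Real.sqrt (energy h)) ^ 2 := by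
  sorry

/-- **B3 `coat_split`** (S, coefficient algebra, SINGLE-SHELL core; k2-H3).  If the core lives on one shell
`|k|² = n₀` and `h ⊥ C` in `ℓ²`, then `h ⊥ C` in `ḣ¹` too, so energy AND dissipation of `C + h` split, and
`dissipation ν C = ν·4π²n₀·energy C`. [folklore] -/
theorem coat_split {N : ℕ} {n₀ : ℝ} {C h : Coeff N}
    (hshell : ∀ k : ↥(modes (Fin 3) N), C k ≠ 0 → freqNormSq (k : Fin 3 → ℤ) = n₀)
    (horth : (∑ k, (inner ℂ (C k) (h k)).re) = 0) (ν : ℝ) :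
    energy (C + h) = energy C + energy h ∧
      dissipation ν (C + h) = dissipation ν C + dissipation ν h ∧
      dissipation ν C = ν * (4 * Real.pi ^ 2 * n₀) * energy C := by
  sorry

/-- **B4 `coat_dissipation_eq_production`** (M, SINGLE-SHELL core; k2-H4 — the exact diagnostic identity).
Testing the coat equation against `fieldOf N h` (`sum_re_inner_galerkinField_test`, force `0`), the core's exactness
against the same field, `integral_inner_convect_self_eq_zero`, `integral_inner_convect_eq_neg`:
`ν‖∇h‖² = −∫⟪h̃, (h̃·∇)C̃⟫` — the coat's own dissipation IS the Reynolds-stress production on the core strain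
(the observable of kill criterion K-3). [folklore] -/
theorem coat_dissipation_eq_production {N : ℕ} {n₀ ν s : ℝ} {C h : Coeff N}
    (hC : C ∈ galerkinSubspace (modes (Fin 3) N)) (hcore : galerkinRHS (modes (Fin 3) N) 0 0 C = 0)
    (hshell : ∀ k : ↥(modes (Fin 3) N), C k ≠ 0 → freqNormSq (k : Fin 3 → ℤ) = n₀)
    (hh : h ∈ galerkinSubspace (modes (Fin 3) N)) (horth : (∑ k, (inner ℂ (C k) (h k)).re) = 0)
    (hs : galerkinRHS (modes (Fin 3) N) ν 0 (C + h) = (-s) • C) :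
    dissipation ν h = -∫ x, ⟪fieldOf N h x, convect (fieldOf N h) (fieldOf N C) x⟫_ℝ := by
  sorry

/-! ## §C  Force-coordinate heart, chart transport, bookkeeping to the registered signature -/

/-- **§C' the heart in FORCE coordinates** (`SteadyTubeLadder`, k3; = k1's `LoudSteadyBranches` with the window
written `[ε, qε]`).  ONE core shape `Cfun` (support `modes K₀`); budgets `E`, `ε > 0`; a loudness ratio `q ≥ 1` and a
viscosity span `r > q²`; force viscosities `a j → 0⁺`; for every `j`, FREQUENTLY in `N`: the restriction `C` is an
exact Euler core at level `N` and a CONNECTED set `Z` of Galerkin steady states of the FIXED force vector `C`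
(`galerkinRHS (modes N) ν' C c = 0`, real solenoidal) with `energy c ≤ E`, `ε ≤ dissipation ν' c ≤ qε`, whose
viscosities cover `[a j, r · a j]`.  This is where the numerics, `coat_chart_onto`, BRR/N–K (sibling 2987) and the
tube lemmas §A all live.  Register (inlined) as `stub_steadyTubeLadder` — the NEW heart (XL / open: for all `j` it
is the steady zeroth law along a branch of the eigen-force `C`). -/
def SteadyTubeLadder : Prop :=
  ∃ (K₀ : ℕ) (Cfun : (Fin 3 → ℤ) → EuclideanSpace ℂ (Fin 3)), (∀ k ∉ modes (Fin 3) K₀, Cfun k = 0) ∧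
    ∃ (E ε q r : ℝ) (a : ℕ → ℝ), 0 < ε ∧ 1 ≤ q ∧ q ^ 2 < r ∧ (∀ j, 0 < a j) ∧ Tendsto a atTop (𝓝 0) ∧
      ∀ j, ∃ᶠ N in atTop, ∃ C : Coeff N, (C = fun k : ↥(modes (Fin 3) N) => Cfun k) ∧
        (C ∈ galerkinSubspace (modes (Fin 3) N) ∧ C ≠ 0 ∧ galerkinRHS (modes (Fin 3) N) 0 0 C = 0) ∧
        ∃ Z : Set (ℝ × Coeff N), IsConnected Z ∧
          (∀ p ∈ Z, p.2 ∈ galerkinSubspace (modes (Fin 3) N) ∧ galerkinRHS (modes (Fin 3) N) p.1 C p.2 = 0 ∧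
            energy p.2 ≤ E ∧ ε ≤ dissipation p.1 p.2 ∧ dissipation p.1 p.2 ≤ q * ε) ∧
          Icc (a j) (r * a j) ⊆ Prod.fst '' Z

/-- **C1 `coatFamily_of_forceFamily`** (M; k3-H4 = k1-H6).  A CONNECTED family `Z` of loud bounded steady states
of the FIXED force `C` covering `[a, b]` in viscosity is carried by the landed chart `coat_chart_onto` (pointwise) and
the continuity of `Φ(ν', c) = (energy C / dissipation ν' c · ν', (energy C / dissipation ν' c) • c − C)` on
`{dissipation > 0} ⊇ Z` (`continuous_dissipation_coat` pattern; `IsConnected.image`) to a CONNECTED coat family with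
transported windows `energy (C+h) ≤ E(E_C/ε)²`, `dissipation ∈ [E_C³/(qε)², E_C³/ε²]`, whose clamp viscosities
cover `[aE_C/ε, bE_C/(qε)]` (`IsPreconnected.Icc_subset` on `fst '' Φ(Z)`: at `ν' = a` the clamp viscosity is
`≤ aE_C/ε`, at `ν' = b` it is `≥ bE_C/(qε)`). [folklore] -/
theorem coatFamily_of_forceFamily (N : ℕ) (C : Coeff N) (hC : C ∈ galerkinSubspace (modes (Fin 3) N)) (hC0 : C ≠ 0)
    (Z : Set (ℝ × Coeff N)) (E ε q a b : ℝ) (hε : 0 < ε) (hq : 1 ≤ q) (ha : 0 < a) (hab : a ≤ b)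
    (hZ : IsConnected Z)
    (hZst : ∀ p ∈ Z, p.2 ∈ galerkinSubspace (modes (Fin 3) N) ∧ galerkinRHS (modes (Fin 3) N) p.1 C p.2 = 0 ∧
      energy p.2 ≤ E ∧ ε ≤ dissipation p.1 p.2 ∧ dissipation p.1 p.2 ≤ q * ε)
    (hcov : Icc a b ⊆ Prod.fst '' Z) :
    ∃ K : Set (ℝ × Coeff N), IsConnected K ∧
      (∀ p ∈ K, (p.2 ∈ galerkinSubspace (modes (Fin 3) N) ∧ (∑ k, (inner ℂ (C k) (p.2 k)).re) = 0 ∧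
          ∃ s : ℝ, galerkinRHS (modes (Fin 3) N) p.1 0 (C + p.2) = (-s) • C) ∧
        energy (C + p.2) ≤ E * (energy C / ε) ^ 2 ∧
        energy C ^ 3 / (q * ε) ^ 2 ≤ dissipation p.1 (C + p.2) ∧ dissipation p.1 (C + p.2) ≤ energy C ^ 3 / ε ^ 2) ∧
      Icc (a * (energy C / ε)) (b * (energy C / (q * ε))) ⊆ Prod.fst '' K := by
  sorry

/-- **C2 `stub_of_steadyTubeLadder`** (M, bookkeeping; k3-H5 = k1's force-form assembly; conclusion = the
REGISTERED signature of `stub_loudCoatDecades` VERBATIM).  Constants (all `j`- and `N`-free; `E_C :=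
∑_{modes K₀} ‖Cfun k‖²`, level-independent by the landed `energy_restrict_eq` after intersecting `∃ᶠ N` with
`eventually_ge_atTop K₀`): `νlo j := a j · E_C/ε`, `ρ := r/q`, `ε₁ := E_C³/(qε)²`, `M := E_C³/ε²`,
`E₁ := E (E_C/ε)²`; `M < ρ²ε₁ ⟺ q² < r`; `0 < ρ`; per `(j, N)` apply C1 with `b := r · a j`.
Register (hypothesis inlined) as `stub_loudCoatOfLadder`; then the skeleton's heart closes as
`stub_loudCoatDecades := stub_loudCoatOfLadder stub_steadyTubeLadder`. [folklore] -/
theorem stub_of_steadyTubeLadder (hL : SteadyTubeLadder) :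
    ∃ (K₀ : ℕ) (Cfun : (Fin 3 → ℤ) → EuclideanSpace ℂ (Fin 3)), (∀ k ∉ modes (Fin 3) K₀, Cfun k = 0) ∧
    ∃ (E₁ ε₁ M ρ : ℝ) (νlo : ℕ → ℝ), 0 < ε₁ ∧ 0 < ρ ∧ M < ρ ^ 2 * ε₁ ∧ (∀ j, 0 < νlo j) ∧
      Tendsto νlo atTop (𝓝 0) ∧
      ∀ j, ∃ᶠ N in atTop, ∃ C : ↥(modes (Fin 3) N) → EuclideanSpace ℂ (Fin 3),
        (C = fun k : ↥(modes (Fin 3) N) => Cfun k) ∧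
        (C ∈ galerkinSubspace (modes (Fin 3) N) ∧ C ≠ 0 ∧ galerkinRHS (modes (Fin 3) N) 0 0 C = 0) ∧
        ∃ K : Set (ℝ × (↥(modes (Fin 3) N) → EuclideanSpace ℂ (Fin 3))), IsConnected K ∧
          (∀ p ∈ K, (p.2 ∈ galerkinSubspace (modes (Fin 3) N) ∧ (∑ k, (inner ℂ (C k) (p.2 k)).re) = 0 ∧
              ∃ s : ℝ, galerkinRHS (modes (Fin 3) N) p.1 0 (C + p.2) = (-s) • C) ∧
            energy (C + p.2) ≤ E₁ ∧ ε₁ ≤ dissipation p.1 (C + p.2) ∧ dissipation p.1 (C + p.2) ≤ M) ∧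
          Set.Icc (νlo j) (ρ * νlo j) ⊆ Prod.fst '' K := by
  sorry

/-! ## §D  Clamp-coordinate packaging of the coat clause (fallback A only; k1-H4a/H4b) -/

/-- Real `ℓ²` pairing (the skeleton's `rin`; the stub writes it inline). -/
def rin {N : ℕ} (c c' : Coeff N) : ℝ := ∑ k, (inner ℂ (c k) (c' k)).re

/-- The readout-projected unforced residual `G_C(ν, h) = V(ν, C+h) − (rin C V / energy C) • C`. -/
def coatRes {N : ℕ} (C : Coeff N) (ν : ℝ) (h : Coeff N) : Coeff N :=
  galerkinRHS (modes (Fin 3) N) ν 0 (C + h) -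
    (rin C (galerkinRHS (modes (Fin 3) N) ν 0 (C + h)) / energy C) • C

/-- **D1 `coat_clause_iff`** (S).  For `C ≠ 0`, "residual collinear with the core" is `coatRes C ν h = 0`
(`rin C C = energy C`). [folklore] -/
theorem coat_clause_iff {N : ℕ} {ν : ℝ} {C h : Coeff N} (hC0 : C ≠ 0) :
    (∃ s : ℝ, galerkinRHS (modes (Fin 3) N) ν 0 (C + h) = (-s) • C) ↔ coatRes C ν h = 0 := by
  sorry

/-- **D2 `coatRes_mem`** (S–M).  The coat map preserves `W_C := galerkinSubspace ⊓ {rin C · = 0}`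
(`galerkinRHS_mem`), so `G_C(ν, ·)` is a SQUARE map `W_C → W_C` on which §A runs in clamp coordinates. [folklore] -/
theorem coatRes_mem {N : ℕ} {ν : ℝ} {C h : Coeff N} (hC : C ∈ galerkinSubspace (modes (Fin 3) N)) (hC0 : C ≠ 0)
    (hh : h ∈ galerkinSubspace (modes (Fin 3) N)) (horth : rin C h = 0) :
    coatRes C ν h ∈ galerkinSubspace (modes (Fin 3) N) ∧ rin C (coatRes C ν h) = 0 := by
  sorry

end Summit.AnomalousDissipation.AnomalousDissipation.Cruxes.GalerkinSteadyZerothLaw.StubPlanLoudCoatDecades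

end
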